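import Mathlib
import Summits.Ventures.PercRepro.TriangleCapCherryPairs

/-!
# PercRepro — THE BIPARTITE SUB-PROBLEM, EQUALITY CLAUSE: a spanning subgraph of `K(A, Aᶜ)` with `|A| = a` and
`a (k − a) − r` edges attains `Σ_v d(v)² = m k − r (k − 1 − r)` iff its missing cross pairs form a star
(p3, gen 41; part 165)

The `r`-term of the closed form §10av on a fixed bipartition, with its equality clause. For a spanning subgraph
`D` of `K(A, Aᶜ)` (`BipSub D A`: every edge crosses `A`) let `missingGraph D A` be the graph of the cross pairs that
are not edges of `D`, with degrees `h(v)`: `d(v) + h(v) = k − |A|` on `A`, `= |A|` off it, and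
`Σ_v d(v)² + 2 k |E(missing)| = |A| (k − |A|) k + Σ_v h(v)²` (`sum_deg_sq_bipSub`). On the cell `m + r = a (k − a)`
the missing graph has `r` edges and `Σ_v d(v)² + r (k − 1 − r) = m k ⟺ Σ_v h(v)² = r (r + 1) ⟺` the missing pairs
are pairwise adjacent (the pair count of part 125) `⟺` they share a vertex (`MissingStar D A v`: a
pairwise-intersecting family of cross pairs has no triangle, so it is a star): `closed_form_eq_of_missingStar`,
`exists_missingStar_of_closed_form_eq`. Axioms: standard.
-/

namespace PercRepro

namespace TriangleCap

namespace C047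

open Finset

variable {V : Type*} [Fintype V] [DecidableEq V]

/-- `D` is a spanning subgraph of the complete bipartite graph with parts `A`, `Aᶜ`: every edge crosses `A`. -/
def BipSub (D : SimpleGraph V) (A : Finset V) : Prop := ∀ x y, D.Adj x y → (x ∈ A ↔ y ∉ A)

/-- The missing cross pairs of `D` in `K(A, Aᶜ)` all contain `v`: they form a star at `v`. -/
def MissingStar (D : SimpleGraph V) (A : Finset V) (v : V) : Prop :=
  ∀ x y, x ∈ A → y ∉ A → ¬ D.Adj x y → x = v ∨ y = v

/-- The missing graph: the cross pairs of `K(A, Aᶜ)` that are not edges of `D`. -/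
def missingGraph (D : SimpleGraph V) (A : Finset V) : SimpleGraph V where
  Adj x y := (x ∈ A ↔ y ∉ A) ∧ ¬ D.Adj x y
  symm := by
    constructor
    intro x y h
    refine ⟨?_, fun h' => h.2 h'.symm⟩
    have := h.1
    tauto
  loopless := by
    constructor
    intro x h
    have := h.1
    tauto

/-- Adjacency in the missing graph is decidable. -/
instance decidableRelMissingGraph (D : SimpleGraph V) [DecidableRel D.Adj] (A : Finset V) :
    DecidableRel (missingGraph D A).Adj :=
  fun x y => inferInstanceAs (Decidable ((x ∈ A ↔ y ∉ A) ∧ ¬ D.Adj x y))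

omit [Fintype V] in
/-- Adjacency in the missing graph. -/
theorem missingGraph_adj (D : SimpleGraph V) (A : Finset V) (x y : V) :
    (missingGraph D A).Adj x y ↔ (x ∈ A ↔ y ∉ A) ∧ ¬ D.Adj x y := Iff.rfl

omit [Fintype V] in
/-- The missing graph is itself a spanning subgraph of `K(A, Aᶜ)`. -/
theorem bipSub_missingGraph (D : SimpleGraph V) (A : Finset V) : BipSub (missingGraph D A) A := fun _ _ h => h.1

omit [DecidableEq V] in
/-- The degree as a sum of indicators. -/
theorem deg_eq_sum_boole (H : SimpleGraph V) [DecidableRel H.Adj] (x : V) :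
    deg H x = ∑ y, if H.Adj x y then 1 else 0 := by
  unfold deg
  rw [card_filter]

/-- **The degrees split:** for `D ≤ K(A, Aᶜ)`, `d_D(x) + d_{missing}(x) = k − |A|` on `A` and `= |A|` off `A`. -/
theorem deg_add_deg_missingGraph (D : SimpleGraph V) [DecidableRel D.Adj] (A : Finset V) (hD : BipSub D A) (x : V) :
    deg D x + deg (missingGraph D A) x = if x ∈ A then Fintype.card V - A.card else A.card := by
  unfold deg
  have hdisj : Disjoint (univ.filter (fun w => D.Adj x w)) (univ.filter (fun w => (missingGraph D A).Adj x w)) := by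
    rw [disjoint_filter]
    intro w _ h1 h2
    exact h2.2 h1
  rw [← card_union_of_disjoint hdisj]
  by_cases hx : x ∈ A
  · rw [if_pos hx, ← card_compl]
    congr 1
    ext w
    simp only [mem_union, mem_filter, mem_univ, true_and, mem_compl, missingGraph_adj]
    constructor
    · rintro (h | h)
      · exact (hD x w h).mp hx
      · exact h.1.mp hx
    · intro hw
      by_cases h : D.Adj x w
      · exact Or.inl h
      · exact Or.inr ⟨by tauto, h⟩
  · rw [if_neg hx]
    congr 1
    ext w
    simp only [mem_union, mem_filter, mem_univ, true_and, missingGraph_adj]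
    constructor
    · rintro (h | h)
      · have := hD x w h; tauto
      · have := h.1; tauto
    · intro hw
      by_cases h : D.Adj x w
      · exact Or.inl h
      · exact Or.inr ⟨by tauto, h⟩

/-- For a spanning subgraph of `K(A, Aᶜ)` the degree sums over the two parts agree. -/
theorem sum_deg_part_eq (H : SimpleGraph V) [DecidableRel H.Adj] (A : Finset V) (hH : BipSub H A) :
    ∑ x ∈ A, deg H x = ∑ y ∈ Aᶜ, deg H y := by
  have e1 : ∑ x ∈ A, deg H x = ∑ x ∈ A, ∑ y ∈ Aᶜ, (if H.Adj x y then 1 else 0) := by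
    apply sum_congr rfl
    intro x hx
    rw [deg_eq_sum_boole, ← sum_add_sum_compl A]
    have h0 : ∑ y ∈ A, (if H.Adj x y then 1 else 0) = 0 := by
      apply sum_eq_zero
      intro y hy
      rw [if_neg]
      intro h
      exact ((hH x y h).mp hx) hy
    rw [h0, zero_add]
  have e2 : ∑ y ∈ Aᶜ, deg H y = ∑ y ∈ Aᶜ, ∑ x ∈ A, (if H.Adj x y then 1 else 0) := by
    apply sum_congr rfl
    intro y hy
    rw [mem_compl] at hy
    rw [deg_eq_sum_boole, ← sum_add_sum_compl A]
    have h0 : ∑ x ∈ Aᶜ, (if H.Adj y x then 1 else 0) = 0 := by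
      apply sum_eq_zero
      intro x hx
      rw [mem_compl] at hx
      rw [if_neg]
      intro h
      have := hH y x h; tauto
    rw [h0, add_zero]
    apply sum_congr rfl
    intro x _
    exact if_congr (H.adj_comm y x) rfl rfl
  rw [e1, e2, sum_comm]

/-- For a spanning subgraph of `K(A, Aᶜ)` the degree sum over `A` is the number of edges. -/
theorem sum_deg_part_eq_card_edges (H : SimpleGraph V) [DecidableRel H.Adj] (A : Finset V) (hH : BipSub H A) :
    ∑ x ∈ A, deg H x = H.edgeFinset.card := by
  have h1 := sum_deg_eq H
  have h2 := sum_add_sum_compl A (fun x => deg H x)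
  have h3 := sum_deg_part_eq H A hH
  omega

/-- A sum of a two-valued function of membership in `A`. -/
theorem sum_ite_mem_card (A : Finset V) (p q : ℕ) :
    ∑ v, (if v ∈ A then p else q) = A.card * p + (Fintype.card V - A.card) * q := by
  rw [← sum_add_sum_compl A, ← card_compl]
  congr 1
  · exact sum_const_nat (fun v hv => if_pos hv)
  · exact sum_const_nat (fun v hv => if_neg (mem_compl.mp hv))

/-- **THE IDENTITY OF THE BIPARTITE SUB-PROBLEM:** for `D ≤ K(A, Aᶜ)` with missing graph `H`,
`Σ_v d(v)² + 2 k |E(H)| = |A| (k − |A|) k + Σ_v h(v)²`. -/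
theorem sum_deg_sq_bipSub (D : SimpleGraph V) [DecidableRel D.Adj] (A : Finset V) (hD : BipSub D A) :
    ∑ v, deg D v * deg D v + 2 * (Fintype.card V * (missingGraph D A).edgeFinset.card) =
      A.card * (Fintype.card V - A.card) * Fintype.card V +
        ∑ v, deg (missingGraph D A) v * deg (missingGraph D A) v := by
  have hsplit : ∀ v, deg D v + deg (missingGraph D A) v =
      if v ∈ A then Fintype.card V - A.card else A.card := fun v => deg_add_deg_missingGraph D A hD v
  have hpt : ∀ v, deg D v * deg D v +
      2 * ((if v ∈ A then Fintype.card V - A.card else A.card) * deg (missingGraph D A) v) =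
      (if v ∈ A then Fintype.card V - A.card else A.card) *
        (if v ∈ A then Fintype.card V - A.card else A.card) +
        deg (missingGraph D A) v * deg (missingGraph D A) v := by
    intro v
    rw [← hsplit v]
    ring
  have hsum : ∑ v, deg D v * deg D v +
      2 * ∑ v, (if v ∈ A then Fintype.card V - A.card else A.card) * deg (missingGraph D A) v =
      ∑ v, (if v ∈ A then Fintype.card V - A.card else A.card) *
        (if v ∈ A then Fintype.card V - A.card else A.card) +
        ∑ v, deg (missingGraph D A) v * deg (missingGraph D A) v := by
    rw [mul_sum, ← sum_add_distrib, ← sum_add_distrib]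
    exact sum_congr rfl (fun v _ => hpt v)
  have hle := card_le_univ A
  have hch : ∑ v, (if v ∈ A then Fintype.card V - A.card else A.card) * deg (missingGraph D A) v =
      Fintype.card V * (missingGraph D A).edgeFinset.card := by
    rw [← sum_add_sum_compl A]
    have h1 : ∑ v ∈ A, (if v ∈ A then Fintype.card V - A.card else A.card) * deg (missingGraph D A) v =
        (Fintype.card V - A.card) * ∑ v ∈ A, deg (missingGraph D A) v := by
      rw [mul_sum]
      apply sum_congr rfl
      intro v hv
      rw [if_pos hv]
    have h2 : ∑ v ∈ Aᶜ, (if v ∈ A then Fintype.card V - A.card else A.card) * deg (missingGraph D A) v =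
        A.card * ∑ v ∈ Aᶜ, deg (missingGraph D A) v := by
      rw [mul_sum]
      apply sum_congr rfl
      intro v hv
      rw [if_neg (mem_compl.mp hv)]
    rw [h1, h2, ← sum_deg_part_eq (missingGraph D A) A (bipSub_missingGraph D A),
      sum_deg_part_eq_card_edges (missingGraph D A) A (bipSub_missingGraph D A), ← add_mul, Nat.sub_add_cancel hle]
  have hcc : ∑ v, (if v ∈ A then Fintype.card V - A.card else A.card) *
      (if v ∈ A then Fintype.card V - A.card else A.card) =
      A.card * (Fintype.card V - A.card) * Fintype.card V := by
    have e : ∀ v, (if v ∈ A then Fintype.card V - A.card else A.card) *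
        (if v ∈ A then Fintype.card V - A.card else A.card) =
        if v ∈ A then (Fintype.card V - A.card) * (Fintype.card V - A.card) else A.card * A.card := by
      intro v
      by_cases hv : v ∈ A <;> simp [hv]
    rw [sum_congr rfl (fun v _ => e v), sum_ite_mem_card]
    obtain ⟨t, ht⟩ : ∃ t, Fintype.card V = A.card + t := ⟨_, (Nat.add_sub_cancel' hle).symm⟩
    rw [ht, Nat.add_sub_cancel_left]
    ring
  rw [hch, hcc] at hsum
  exact hsum

/-- On the cell `m + r = a (k − a)` the missing graph of `D ≤ K(A, Aᶜ)`, `|A| = a`, has `r` edges. -/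
theorem card_edges_missingGraph (D : SimpleGraph V) [DecidableRel D.Adj] (A : Finset V) (hD : BipSub D A) (a r : ℕ)
    (hA : A.card = a) (hm : D.edgeFinset.card + r = a * (Fintype.card V - a)) :
    (missingGraph D A).edgeFinset.card = r := by
  have h1 := sum_deg_eq D
  have h2 := sum_deg_eq (missingGraph D A)
  have h3 : ∑ v, (deg D v + deg (missingGraph D A) v) =
      ∑ v, (if v ∈ A then Fintype.card V - A.card else A.card) :=
    sum_congr rfl (fun v _ => deg_add_deg_missingGraph D A hD v)
  rw [sum_add_distrib, sum_ite_mem_card, hA] at h3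
  have hle := card_le_univ A
  rw [hA] at hle
  obtain ⟨t, ht⟩ : ∃ t, Fintype.card V = a + t := ⟨_, (Nat.add_sub_cancel' hle).symm⟩
  rw [ht, Nat.add_sub_cancel_left] at h3 hm
  nlinarith [h1, h2, h3, hm]

/-- **THE EQUALITY CLAUSE, DEGREE FORM:** on the cell `m + r = a (k − a)` with `r + 1 ≤ k`, a spanning subgraph
of `K(A, Aᶜ)` with `|A| = a` attains `Σ_v d(v)² + r (k − 1 − r) = m k` iff its missing graph has `Σ_v h(v)² =
r (r + 1)`. -/
theorem closed_form_eq_iff_sum_missing (D : SimpleGraph V) [DecidableRel D.Adj] (A : Finset V) (hD : BipSub D A)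
    (a r : ℕ) (hA : A.card = a) (hm : D.edgeFinset.card + r = a * (Fintype.card V - a))
    (hr : r + 1 ≤ Fintype.card V) :
    ∑ v, deg D v * deg D v + r * (Fintype.card V - 1 - r) = D.edgeFinset.card * Fintype.card V ↔
      ∑ v, deg (missingGraph D A) v * deg (missingGraph D A) v = r * (r + 1) := by
  have key := sum_deg_sq_bipSub D A hD
  rw [card_edges_missingGraph D A hD a r hA hm, hA] at key
  obtain ⟨s, hs⟩ : ∃ s, Fintype.card V = r + 1 + s := ⟨_, (Nat.add_sub_cancel' hr).symm⟩
  have e : r + 1 + s - 1 - r = s := by omega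
  rw [hs, e]
  rw [hs] at key hm
  generalize hS : ∑ v, deg D v * deg D v = S at key
  generalize hH : ∑ v, deg (missingGraph D A) v * deg (missingGraph D A) v = H at key
  generalize hM : D.edgeFinset.card = M at key hm
  constructor
  · intro h
    nlinarith [key, hm, h]
  · intro h
    nlinarith [key, hm, h]

/-- `Σ_v h(v)² = r (r + 1)` for a graph with `r` edges iff its edges are pairwise adjacent (the pair count). -/
theorem sum_deg_sq_eq_iff_pairwiseAdjacent (H : SimpleGraph V) [DecidableRel H.Adj] (r : ℕ)
    (hr : H.edgeFinset.card = r) :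
    ∑ v, deg H v * deg H v = r * (r + 1) ↔ PairwiseAdjacent H := by
  rw [← cherries_eq_choose_two_iff, hr]
  have h1 := two_mul_cherries_add H
  have h2 := sum_deg_eq H
  have h3 := two_mul_choose_two_add r
  rw [hr] at h2
  have h4 : r * (r + 1) = r * r + r := by ring
  constructor
  · intro h
    omega
  · intro h
    omega

/-- Two distinct missing pairs `(x, y)`, `(x', y')` with `x, x' ∈ A` of a pairwise-adjacent missing graph share
an end: `x = x'` or `y = y'`. -/
theorem missing_share_of_pairwiseAdjacent (D : SimpleGraph V) [DecidableRel D.Adj] (A : Finset V)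
    (hpa : PairwiseAdjacent (missingGraph D A)) {x y x' y' : V} (h : (missingGraph D A).Adj x y)
    (h' : (missingGraph D A).Adj x' y') (hx : x ∈ A) (hx' : x' ∈ A) (hne : ¬ (x = x' ∧ y = y')) :
    x = x' ∨ y = y' := by
  have hy : y ∉ A := h.1.mp hx
  have hy' : y' ∉ A := h'.1.mp hx'
  have he : s(x, y) ∈ (missingGraph D A).edgeFinset := by
    rw [SimpleGraph.mem_edgeFinset, SimpleGraph.mem_edgeSet]
    exact h
  have hf : s(x', y') ∈ (missingGraph D A).edgeFinset := by
    rw [SimpleGraph.mem_edgeFinset, SimpleGraph.mem_edgeSet]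
    exact h'
  have hef : s(x, y) ≠ s(x', y') := by
    intro heq
    rw [Sym2.eq_iff] at heq
    rcases heq with ⟨h1, h2⟩ | ⟨h1, h2⟩
    · exact hne ⟨h1, h2⟩
    · rw [h1] at hx
      exact hy' hx
  obtain ⟨z, hz1, hz2⟩ := hpa _ he _ hf hef
  rw [Sym2.mem_iff] at hz1 hz2
  rcases hz1 with rfl | rfl
  · rcases hz2 with h1 | h1
    · exact Or.inl h1
    · rw [h1] at hx
      exact absurd hx hy'
  · rcases hz2 with h1 | h1
    · rw [h1] at hy
      exact absurd hx' hy
    · exact Or.inr h1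

/-- A pairwise-adjacent missing graph with a missing pair `(x₀, y₀)` is a star. -/
theorem missingStar_of_pairwiseAdjacent_aux (D : SimpleGraph V) [DecidableRel D.Adj] (A : Finset V)
    (hpa : PairwiseAdjacent (missingGraph D A)) {x₀ y₀ : V} (hx₀ : x₀ ∈ A) (hy₀ : y₀ ∉ A) (h₀ : ¬ D.Adj x₀ y₀) :
    ∃ v, MissingStar D A v := by
  have hm₀ : (missingGraph D A).Adj x₀ y₀ := ⟨by tauto, h₀⟩
  by_cases hall : ∀ x y, x ∈ A → y ∉ A → ¬ D.Adj x y → x = x₀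
  · exact ⟨x₀, fun x y hx hy hxy => Or.inl (hall x y hx hy hxy)⟩
  push Not at hall
  obtain ⟨x₁, y₁, hx₁, hy₁, h₁, hne₁⟩ := hall
  have hm₁ : (missingGraph D A).Adj x₁ y₁ := ⟨by tauto, h₁⟩
  have hy₁₀ : y₁ = y₀ := by
    rcases missing_share_of_pairwiseAdjacent D A hpa hm₁ hm₀ hx₁ hx₀ (fun h => hne₁ h.1) with h | h
    · exact absurd h hne₁
    · exact h
  subst hy₁₀
  refine ⟨y₁, fun x y hx hy hxy => ?_⟩
  by_cases hyy : y = y₁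
  · exact Or.inr hyy
  have hm : (missingGraph D A).Adj x y := ⟨by tauto, hxy⟩
  have e0 : x = x₀ := by
    rcases missing_share_of_pairwiseAdjacent D A hpa hm hm₀ hx hx₀ (fun h => hyy h.2) with h | h
    · exact h
    · exact absurd h hyy
  have e1 : x = x₁ := by
    rcases missing_share_of_pairwiseAdjacent D A hpa hm hm₁ hx hx₁ (fun h => hyy h.2) with h | h
    · exact h
    · exact absurd h hyy
  exact absurd (e0.symm.trans e1) (Ne.symm hne₁)

/-- **A pairwise-adjacent missing graph is a star** (a pairwise-intersecting family of cross pairs has no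
triangle). -/
theorem missingStar_of_pairwiseAdjacent (D : SimpleGraph V) [DecidableRel D.Adj] (A : Finset V) [Nonempty V]
    (hpa : PairwiseAdjacent (missingGraph D A)) : ∃ v, MissingStar D A v := by
  by_cases h : ∃ x y, x ∈ A ∧ y ∉ A ∧ ¬ D.Adj x y
  · obtain ⟨x₀, y₀, hx₀, hy₀, h₀⟩ := h
    exact missingStar_of_pairwiseAdjacent_aux D A hpa hx₀ hy₀ h₀
  · push Not at h
    obtain ⟨v⟩ := ‹Nonempty V›
    exact ⟨v, fun x y hx hy hxy => absurd (h x y hx hy) hxy⟩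

omit [Fintype V] in
/-- A missing pair of a star contains its centre. -/
theorem missingStar_adj (D : SimpleGraph V) [DecidableRel D.Adj] (A : Finset V) {v : V} (hv : MissingStar D A v)
    {x y : V} (h : (missingGraph D A).Adj x y) : x = v ∨ y = v := by
  by_cases hx : x ∈ A
  · exact hv x y hx (h.1.mp hx) h.2
  · have hy : y ∈ A := by
      have := h.1
      tauto
    rcases hv y x hy hx (fun h' => h.2 h'.symm) with h1 | h1
    · exact Or.inr h1
    · exact Or.inl h1

/-- **A star is pairwise adjacent.** -/
theorem pairwiseAdjacent_of_missingStar (D : SimpleGraph V) [DecidableRel D.Adj] (A : Finset V) {v : V}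
    (hv : MissingStar D A v) : PairwiseAdjacent (missingGraph D A) := by
  intro e he f hf _
  revert he
  refine Sym2.ind (fun x y => ?_) e
  intro he
  revert hf
  refine Sym2.ind (fun x' y' => ?_) f
  intro hf
  rw [SimpleGraph.mem_edgeFinset, SimpleGraph.mem_edgeSet] at he hf
  refine ⟨v, ?_, ?_⟩
  · rw [Sym2.mem_iff]
    rcases missingStar_adj D A hv he with h | h
    · exact Or.inl h.symm
    · exact Or.inr h.symm
  · rw [Sym2.mem_iff]
    rcases missingStar_adj D A hv hf with h | h
    · exact Or.inl h.symm
    · exact Or.inr h.symm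

/-- **THE EQUALITY CLAUSE OF THE BIPARTITE SUB-PROBLEM, (⇐):** a spanning subgraph of `K(A, Aᶜ)`, `|A| = a`,
with `a (k − a) − r` edges whose missing pairs form a star attains `Σ_v d(v)² + r (k − 1 − r) = m k`. -/
theorem closed_form_eq_of_missingStar (D : SimpleGraph V) [DecidableRel D.Adj] (A : Finset V) (hD : BipSub D A)
    {v : V} (hv : MissingStar D A v) (a r : ℕ) (hA : A.card = a)
    (hm : D.edgeFinset.card + r = a * (Fintype.card V - a)) (hr : r + 1 ≤ Fintype.card V) :
    ∑ v, deg D v * deg D v + r * (Fintype.card V - 1 - r) = D.edgeFinset.card * Fintype.card V := by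
  rw [closed_form_eq_iff_sum_missing D A hD a r hA hm hr,
    sum_deg_sq_eq_iff_pairwiseAdjacent (missingGraph D A) r (card_edges_missingGraph D A hD a r hA hm)]
  exact pairwiseAdjacent_of_missingStar D A hv

/-- **THE EQUALITY CLAUSE OF THE BIPARTITE SUB-PROBLEM, (⇒):** a spanning subgraph of `K(A, Aᶜ)`, `|A| = a`,
with `a (k − a) − r` edges attaining `Σ_v d(v)² + r (k − 1 − r) = m k` has its missing pairs in a star. -/
theorem exists_missingStar_of_closed_form_eq (D : SimpleGraph V) [DecidableRel D.Adj] (A : Finset V)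
    (hD : BipSub D A) (a r : ℕ) (hA : A.card = a) (hm : D.edgeFinset.card + r = a * (Fintype.card V - a))
    (hr : r + 1 ≤ Fintype.card V)
    (heq : ∑ v, deg D v * deg D v + r * (Fintype.card V - 1 - r) = D.edgeFinset.card * Fintype.card V) :
    ∃ v, MissingStar D A v := by
  have hne : Nonempty V := Fintype.card_pos_iff.mp (by omega)
  rw [closed_form_eq_iff_sum_missing D A hD a r hA hm hr,
    sum_deg_sq_eq_iff_pairwiseAdjacent (missingGraph D A) r (card_edges_missingGraph D A hD a r hA hm)] at heq
  exact missingStar_of_pairwiseAdjacent D A heq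

end C047

end TriangleCap

end PercRepro
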